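import Mathlib.Order.UpperLower.Basic
import Mathlib.Data.Finset.Powerset
import Mathlib.Data.Finset.Max
import Mathlib.Data.Finset.Card
import Mathlib.Data.Finset.SDiff
import HarnessLib

/-!
# `NoHeavyLowerTail` (crux stmt-CriticalPhenomena-4575), P3 lane: THE TWISTED KLEITMAN INEQUALITY
# (the `t = 1` case of the ordered coefficientwise conjecture (R*) of memo g35)

Support file (seat `prim-l12-p3`, gen 35; `--supports stmt-CriticalPhenomena-4575`).  Memo
`run/shared/lean/prim/prim-l12/FROM-prim-l12-p3-g35-ENTRANCE-STOPPED-PROJECTIONS.md` §4.1.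

Let `α` be linearly ordered, `R : Finset α`, and for a nonempty `W ⊆ R` with minimum `k` put
`ψ_R(W) := {k} ∪ {x ∈ R \ W : k < x}` — keep the minimum of `W`, take the complement of `W` strictly above it, and drop
everything below it (an order-dependent "partial complement"; it is NOT a superset of the full complement `R \ W`).
In the statements `ψ_R(W)` is written definition-free as the filter `{x ∈ R : (x ∈ W ∧ ∀ y ∈ W, x ≤ y) ∨ (x ∉ W ∧ ∃ y ∈ W, y < x)}`
(spelled out in each statement; the gate admits no local notation).
THEOREM (`card_compl_mem_le_card_psi_mem`): for up-sets `𝒜, ℬ` of finite sets,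
    `#{W ⊆ R : W ≠ ∅, W ∈ 𝒜, R \ W ∈ ℬ} ≤ #{W ⊆ R : W ≠ ∅, W ∈ 𝒜, ψ_R(W) ∈ ℬ}`.
This is the squarefree `t = 1` instance of the ordered refinement `R*_σ ∈ ℕ[r]` of the transfer principle (memo §3–4): with
the identity `R_t = R*_σ + (Harris residual)` it re-proves coefficientwise Harris/Kleitman through a STRONGER ordered statement.
Proof: induction on `#R`, peeling the minimum `a` of `R`; for `W ∋ a` one has `ψ_R(W) = (R \ W) ∪ {a} ⊇ R \ W`, for `W ∌ a`
one has `ψ_R(W) = ψ_{R∖a}(W)` while `R \ W = (R∖a \ W) ∪ {a}`; the two boundary terms compare through `𝒜 ∋ W ⇒ 𝒜 ∋ W ∪ {a}`.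
Nothing is asserted about the crux.
-/

namespace Summit.CriticalPhenomena.PercolationContinuityZ3.Theorems

namespace SahiCTCTwistedKleitman

open Finset

variable {α : Type*} [LinearOrder α]

/-- For `W = W' ∪ {a}` with `a` below all of `R' ⊇ W'`: `ψ_{R'∪{a}}(W) = (R' \ W') ∪ {a}` — for the sets containing
the new minimum the twisted complement CONTAINS the plain complement. [this work] -/
theorem psi_insert_insert {a : α} {R' W' : Finset α} (ha : ∀ x ∈ R', a < x) (hW : W' ⊆ R') :
    (Finset.filter (fun v => (v ∈ insert a W' ∧ ∀ w ∈ insert a W', v ≤ w) ∨ (v ∉ insert a W' ∧ ∃ w ∈ insert a W', w < v)) (insert a R')) = insert a (R' \ W') := by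
  have haR : a ∉ R' := fun h => lt_irrefl a (ha a h)
  ext x
  simp only [mem_filter, mem_insert, mem_sdiff]
  constructor
  · rintro ⟨hxR, (⟨hxW, hmin⟩ | ⟨hxW, y, hy, hyx⟩)⟩
    · rcases hxW with rfl | hxW
      · exact Or.inl rfl
      · exact absurd (hmin a (Or.inl rfl)) (not_le.mpr (ha x (hW hxW)))
    · rw [not_or] at hxW
      rcases hxR with rfl | hxR
      · exact absurd rfl hxW.1
      · exact Or.inr ⟨hxR, hxW.2⟩
  · rintro (rfl | ⟨hxR, hxW⟩)
    · refine ⟨Or.inl rfl, Or.inl ⟨Or.inl rfl, ?_⟩⟩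
      rintro y (rfl | hy)
      · exact le_rfl
      · exact le_of_lt (ha y (hW hy))
    · refine ⟨Or.inr hxR, Or.inr ⟨?_, a, Or.inl rfl, ha x hxR⟩⟩
      rintro (rfl | h)
      · exact haR hxR
      · exact hxW h

/-- For `W' ⊆ R'` with `a` below all of `R'`: `ψ_{R'∪{a}}(W') = ψ_{R'}(W')` (the new minimum lies below `W'` and is
dropped). [this work] -/
theorem psi_insert_of_subset {a : α} {R' W' : Finset α} (ha : ∀ x ∈ R', a < x) (hW : W' ⊆ R') :
    (Finset.filter (fun v => (v ∈ W' ∧ ∀ w ∈ W', v ≤ w) ∨ (v ∉ W' ∧ ∃ w ∈ W', w < v)) (insert a R')) = (Finset.filter (fun v => (v ∈ W' ∧ ∀ w ∈ W', v ≤ w) ∨ (v ∉ W' ∧ ∃ w ∈ W', w < v)) (R')) := by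
  ext x
  simp only [mem_filter, mem_insert]
  constructor
  · rintro ⟨rfl | hxR, hQ⟩
    · exfalso
      rcases hQ with ⟨hxW, _⟩ | ⟨_, y, hy, hyx⟩
      · exact lt_irrefl _ (ha _ (hW hxW))
      · exact lt_asymm hyx (ha y (hW hy))
    · exact ⟨hxR, hQ⟩
  · rintro ⟨hxR, hQ⟩
    exact ⟨Or.inr hxR, hQ⟩

/-- Up-sets are closed under inserting an element: `W' ∈ 𝒜 ⇒ W' ∪ {a} ∈ 𝒜`. [this work] -/
theorem mem_of_insert_upper {𝒜 : Finset (Finset α)} (h𝒜 : IsUpperSet (𝒜 : Set (Finset α))) {a : α}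
    {W' : Finset α} (h : W' ∈ 𝒜) : insert a W' ∈ 𝒜 := by
  have : (W' : Finset α) ≤ insert a W' := subset_insert a W'
  exact h𝒜 this h

/-- **THE TWISTED KLEITMAN INEQUALITY** (memo g35 §4.1, the squarefree `t = 1` case of the ordered conjecture (R*)): for
up-sets `𝒜, ℬ` of finite subsets of a linear order and every finite `R`,
`#{W ⊆ R : W ≠ ∅, W ∈ 𝒜, R \ W ∈ ℬ} ≤ #{W ⊆ R : W ≠ ∅, W ∈ 𝒜, ψ_R(W) ∈ ℬ}`,
`ψ_R(W) = {min W} ∪ {x ∈ R \ W : min W < x}`. [this work] -/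
theorem card_compl_mem_le_card_psi_mem (𝒜 ℬ : Finset (Finset α))
    (h𝒜 : IsUpperSet (𝒜 : Set (Finset α))) (hℬ : IsUpperSet (ℬ : Set (Finset α))) (R : Finset α) :
    (R.powerset.filter fun W => W.Nonempty ∧ W ∈ 𝒜 ∧ R \ W ∈ ℬ).card ≤
      (R.powerset.filter fun W => W.Nonempty ∧ W ∈ 𝒜 ∧ (Finset.filter (fun v => (v ∈ W ∧ ∀ w ∈ W, v ≤ w) ∨ (v ∉ W ∧ ∃ w ∈ W, w < v)) (R)) ∈ ℬ).card := by
  -- induction on the size of `R`, for all up-sets `𝒜` (ℬ fixed)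
  suffices key : ∀ (n : ℕ) (R : Finset α) (𝒜 : Finset (Finset α)), R.card = n →
      IsUpperSet (𝒜 : Set (Finset α)) →
      (R.powerset.filter fun W => W.Nonempty ∧ W ∈ 𝒜 ∧ R \ W ∈ ℬ).card ≤
        (R.powerset.filter fun W => W.Nonempty ∧ W ∈ 𝒜 ∧ (Finset.filter (fun v => (v ∈ W ∧ ∀ w ∈ W, v ≤ w) ∨ (v ∉ W ∧ ∃ w ∈ W, w < v)) (R)) ∈ ℬ).card from key R.card R 𝒜 rfl h𝒜
  intro n
  induction n with
  | zero =>
    intro R 𝒜 hR _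
    rw [card_eq_zero] at hR
    subst hR
    simp only [powerset_empty, filter_singleton, Finset.not_nonempty_empty, false_and, if_false, card_empty, le_refl]
  | succ n ih =>
    intro R 𝒜 hR h𝒜
    have hRne : R.Nonempty := by rw [← card_pos, hR]; exact Nat.succ_pos n
    set a := R.min' hRne with ha_def
    set R' := R.erase a with hR'_def
    have haR : a ∈ R := min'_mem R hRne
    have haR' : a ∉ R' := by rw [hR'_def]; exact notMem_erase a R
    have hRR' : R = insert a R' := by rw [hR'_def, insert_erase haR]
    have hcard : R'.card = n := by
      rw [hR'_def, card_erase_of_mem haR, hR]; rfl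
    have hlt : ∀ x ∈ R', a < x := by
      intro x hx
      rw [hR'_def, mem_erase] at hx
      exact lt_of_le_of_ne (min'_le R x hx.2) (Ne.symm hx.1)
    -- the induction hypothesis for (R', 𝒜)
    have IH := ih R' 𝒜 hcard h𝒜
    -- split the powerset of R = insert a R'
    rw [hRR', powerset_insert]
    have hdisj : Disjoint R'.powerset (R'.powerset.image (insert a)) := by
      rw [disjoint_left]
      intro W hW hW'
      rw [mem_image] at hW'
      obtain ⟨W', _, rfl⟩ := hW'
      exact haR' (mem_powerset.mp hW (mem_insert_self a W'))
    rw [filter_union, filter_union, card_union_of_disjoint (disjoint_filter_filter hdisj),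
      card_union_of_disjoint (disjoint_filter_filter hdisj)]
    -- the parts over `W ⊆ R'` (not containing `a`)
    have part0L : (R'.powerset.filter fun W => W.Nonempty ∧ W ∈ 𝒜 ∧ insert a R' \ W ∈ ℬ) =
        R'.powerset.filter fun W => W.Nonempty ∧ W ∈ 𝒜 ∧ insert a (R' \ W) ∈ ℬ := by
      apply filter_congr
      intro W hW
      rw [insert_sdiff_of_notMem R' (fun h => haR' (mem_powerset.mp hW h))]
    have part0R : (R'.powerset.filter fun W => W.Nonempty ∧ W ∈ 𝒜 ∧ (Finset.filter (fun v => (v ∈ W ∧ ∀ w ∈ W, v ≤ w) ∨ (v ∉ W ∧ ∃ w ∈ W, w < v)) (insert a R')) ∈ ℬ) =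
        R'.powerset.filter fun W => W.Nonempty ∧ W ∈ 𝒜 ∧ (Finset.filter (fun v => (v ∈ W ∧ ∀ w ∈ W, v ≤ w) ∨ (v ∉ W ∧ ∃ w ∈ W, w < v)) (R')) ∈ ℬ := by
      apply filter_congr
      intro W hW
      rw [psi_insert_of_subset hlt (mem_powerset.mp hW)]
    -- the parts over `W = insert a W'`
    have hinj : Set.InjOn (insert a) (R'.powerset : Set (Finset α)) := by
      intro W₁ hW₁ W₂ hW₂ h
      have h1 : a ∉ W₁ := fun hh => haR' (mem_powerset.mp (mem_coe.mp hW₁) hh)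
      have h2 : a ∉ W₂ := fun hh => haR' (mem_powerset.mp (mem_coe.mp hW₂) hh)
      rw [← erase_insert h1, ← erase_insert h2, h]
    have part1L : ((R'.powerset.image (insert a)).filter fun W => W.Nonempty ∧ W ∈ 𝒜 ∧ insert a R' \ W ∈ ℬ).card =
        (R'.powerset.filter fun W' => insert a W' ∈ 𝒜 ∧ R' \ W' ∈ ℬ).card := by
      rw [filter_image, card_image_of_injOn (fun x hx y hy h => hinj (mem_coe.mpr (mem_filter.mp (mem_coe.mp hx)).1)
        (mem_coe.mpr (mem_filter.mp (mem_coe.mp hy)).1) h)]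
      congr 1
      apply filter_congr
      intro W' hW'
      simp only [insert_nonempty, true_and]
      rw [insert_sdiff_insert, sdiff_insert_of_notMem haR']
    have part1R : ((R'.powerset.image (insert a)).filter fun W => W.Nonempty ∧ W ∈ 𝒜 ∧ (Finset.filter (fun v => (v ∈ W ∧ ∀ w ∈ W, v ≤ w) ∨ (v ∉ W ∧ ∃ w ∈ W, w < v)) (insert a R')) ∈ ℬ).card =
        (R'.powerset.filter fun W' => insert a W' ∈ 𝒜 ∧ insert a (R' \ W') ∈ ℬ).card := by
      rw [filter_image, card_image_of_injOn (fun x hx y hy h => hinj (mem_coe.mpr (mem_filter.mp (mem_coe.mp hx)).1)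
        (mem_coe.mpr (mem_filter.mp (mem_coe.mp hy)).1) h)]
      congr 1
      apply filter_congr
      intro W' hW'
      simp only [insert_nonempty, true_and]
      rw [psi_insert_insert hlt (mem_powerset.mp hW')]
    rw [part0L, part0R, part1L, part1R]
    -- X1 + X2 ≤ Y1 + Y2 via X2 = X2' + M2, Y1 = X1 + M1, M2 ≤ M1, X2' ≤ Y2 (IH)
    have splitX2 : (R'.powerset.filter fun W => W.Nonempty ∧ W ∈ 𝒜 ∧ insert a (R' \ W) ∈ ℬ).card =
        (R'.powerset.filter fun W => W.Nonempty ∧ W ∈ 𝒜 ∧ R' \ W ∈ ℬ).card +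
        (R'.powerset.filter fun W => (W.Nonempty ∧ W ∈ 𝒜 ∧ insert a (R' \ W) ∈ ℬ) ∧ R' \ W ∉ ℬ).card := by
      rw [← card_filter_add_card_filter_not (s := R'.powerset.filter fun W => W.Nonempty ∧ W ∈ 𝒜 ∧ insert a (R' \ W) ∈ ℬ)
        (p := fun W => R' \ W ∈ ℬ)]
      rw [filter_filter, filter_filter]
      congr 2
      apply filter_congr
      intro W _
      constructor
      · rintro ⟨⟨h1, h2, _⟩, h4⟩; exact ⟨h1, h2, h4⟩
      · rintro ⟨h1, h2, h3⟩; exact ⟨⟨h1, h2, mem_of_insert_upper hℬ h3⟩, h3⟩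
    have splitY1 : (R'.powerset.filter fun W' => insert a W' ∈ 𝒜 ∧ insert a (R' \ W') ∈ ℬ).card =
        (R'.powerset.filter fun W' => insert a W' ∈ 𝒜 ∧ R' \ W' ∈ ℬ).card +
        (R'.powerset.filter fun W' => (insert a W' ∈ 𝒜 ∧ insert a (R' \ W') ∈ ℬ) ∧ R' \ W' ∉ ℬ).card := by
      rw [← card_filter_add_card_filter_not (s := R'.powerset.filter fun W' => insert a W' ∈ 𝒜 ∧ insert a (R' \ W') ∈ ℬ)
        (p := fun W => R' \ W ∈ ℬ)]
      rw [filter_filter, filter_filter]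
      congr 2
      apply filter_congr
      intro W _
      constructor
      · rintro ⟨⟨h1, _⟩, h4⟩; exact ⟨h1, h4⟩
      · rintro ⟨h1, h3⟩; exact ⟨⟨h1, mem_of_insert_upper hℬ h3⟩, h3⟩
    have M2leM1 : (R'.powerset.filter fun W => (W.Nonempty ∧ W ∈ 𝒜 ∧ insert a (R' \ W) ∈ ℬ) ∧ R' \ W ∉ ℬ).card ≤
        (R'.powerset.filter fun W' => (insert a W' ∈ 𝒜 ∧ insert a (R' \ W') ∈ ℬ) ∧ R' \ W' ∉ ℬ).card := by
      apply card_le_card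
      intro W hW
      rw [mem_filter] at hW ⊢
      obtain ⟨hW, ⟨_, h2, h3⟩, h4⟩ := hW
      exact ⟨hW, ⟨mem_of_insert_upper h𝒜 h2, h3⟩, h4⟩
    rw [splitX2, splitY1]
    omega

end SahiCTCTwistedKleitman

end Summit.CriticalPhenomena.PercolationContinuityZ3.Theorems
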